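import Mathlib
import Summits.ResolutionOfSingularities.ResolutionOfSingularities.Theorems.RadicialJungCleanModelsContactChainResidualLine
import Summits.ResolutionOfSingularities.ResolutionOfSingularities.Theorems.RadicialJungCleanModelsContactChainPresentation
import Summits.ResolutionOfSingularities.ResolutionOfSingularities.Theorems.RadicialJungCleanModelsTransversalNotPowModSq
import HarnessLib

/-!
# Route `RadicialJung`, crux `CleanModels` (stmt-ResolutionOfSingularities-15917), line `Sketch` rev 35, stub 6 `stub_cleanProp44` (X44c),
# work plan O8 — L7b PROVED: clean-regular at a point of a regular curve ⟹ a chain of point blow-ups following the curve reaches a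
# clean-permissible landing

Memo `Cruxes/CleanModels/Lines/Sketch-memo-4e-cleanPermissible.md` §4 (O8 = L7b «permissibilization of a regular curve by point blow-ups») and
`Sketch-memo-hand2-g8-stubs-5-7.md` §2.  THE THEOREM `exists_pointChain_cleanPermissibleAt_of_cleanRegAt`: on a regular integral QUASI-EXCELLENT
`X₀` (`char K(X₀) = p`; X44c's stages are excellent, ✓ `isExcellent_of_isCleanRegularCentreBlowupSeq`), at a closed point `x₀` (`dim 𝒪_{X₀,x₀} = 3`) of a
regular curve `C₀` with a transversal parameter `w`, if the line of `G` is clean-regular at `x₀` (`CleanRegAt p (toFunctionField x₀) G`), then there is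
a dominant chain of point blowing ups following `C₀` ending at a closed point `x` over `x₀` where the line of `σ^♯ G` is CLEAN-PERMISSIBLE for the strict
transform of `C₀`.  No hypothesis at other points, no defect hypothesis, no residual.

Assembly (everything ✓ in the tree): clean form (2) at `x₀` exits at once (✓ `cleanPermissibleAt_of_unit`); form (3) is shifted to a regular parameter
(✓ `rep_shift_sub_pow`, ✓ `isRsopPart_singleton_of_not_mem_sq`) and treated as form (1) with one factor; form (1): a used component inside `𝓘_{C₀}` or
a charge exits (✓ `exists_pointChain_cleanPermissibleAt_or_uncharged_of_looseCleanForm`, p812573); in the all-transversal uncharged configuration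
`u ∏ s_i^{a_i}`: if the unit part `u ∏ γ_i^{a_i}` is not a `p`-th power modulo `𝓘` the restart exit applies (✓ `exists_pointChain_cleanPermissibleAt_of_isQuasiExcellent`,
defectlessness from quasi-excellence, p814715); otherwise the representative is NOT a `p`-th power modulo `𝓘²` (✓ `transversal_rep_not_pow_mod_sq`, the
first-order theorem of `…TransversalNotPowModSq.lean`) and the first-order collapse exits (✓ `exists_pointChain_cleanPermissibleAt_of_rep_not_pow_mod_sq`,
p814829).  In particular the memo's (T2b) «bad pair» configuration never obstructs: it is incompatible with clean-regularity at the point.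

Honest framing: OURS; this closes item O8 (L7b) of the X44c work plan only — nothing here proves X44c (O1–O7 remain), resolution in
characteristic `p`, or any case of `CleanModels`.
-/

noncomputable section

set_option linter.dupNamespace false -- mandated namespace of this single-conjunct summit

open CategoryTheory AlgebraicGeometry TopologicalSpace IsLocalRing
open Literature.AlgebraicGeometry.Resolution Literature.AlgebraicGeometry.Motives
open Scheme.IdealSheafData

namespace Summit.ResolutionOfSingularities.ResolutionOfSingularities.Theorems.RadicialJung.CleanModels

/-- **Exit from a loose clean form (1) presentation.**  On a regular integral quasi-excellent `X₀` (`char K(X₀) = p`), at a closed point `x₀`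
(`dim 𝒪_{X₀,x₀} = 3`) of a regular curve `C₀` with transversal parameter `w`: a representative `u · ∏_{i<m} s_i^{a_i}` of the line (`m ≥ 1`, `s` part of a
regular system of parameters, `p ∤ a_i`, `u` a unit) forces a dominant chain of point blowing ups following `C₀` with a clean-permissible landing.
[cite: CossartJannsenSaito2020, proof of Thm. 6.28, Step 5] [cite: CossartPiltant2008, Prop. 4.4 (proof, p. 10)] [cite: Piltant2013, §2 Axiom 4] -/
theorem exists_pointChain_cleanPermissibleAt_of_monomialRep {X₀ : Scheme.{0}} [IsIntegral X₀] [IsLocallyNoetherian X₀]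
    (hX₀ : Scheme.IsRegular X₀) (hE : Scheme.IsQuasiExcellent X₀) (p : ℕ) [hp : Fact p.Prime] [CharP X₀.functionField p] {C₀ : Closeds X₀}
    (hC₀reg : ∀ y ∈ (C₀ : Set X₀), ∃ c : Fin 2 → X₀.presheaf.stalk y,
      IsRsopPart c ∧ Ideal.span (Set.range c) = stalkIdeal (vanishingIdeal C₀) y)
    {x₀ : X₀} (hx₀ : IsClosed ({x₀} : Set X₀)) (hx₀C : x₀ ∈ (C₀ : Set X₀)) (hdim₀ : ringKrullDim (X₀.presheaf.stalk x₀) = 3)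
    [hP : (stalkIdeal (vanishingIdeal C₀) x₀).IsPrime]
    (w : X₀.presheaf.stalk x₀) (hw : stalkIdeal (vanishingIdeal C₀) x₀ ⊔ Ideal.span {w} = maximalIdeal _)
    (G : X₀.functionField) (cc : Fin p → X₀.functionField) (hcc : ∃ j : Fin p, (j : ℕ) ≠ 0 ∧ cc j ≠ 0)
    {m : ℕ} (hm : 0 < m) (s : Fin m → X₀.presheaf.stalk x₀) (hs : IsRsopPart s) (a : Fin m → ℕ) (ha : ∀ i, ¬ p ∣ a i)
    (u : X₀.presheaf.stalk x₀) (hu : IsUnit u)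
    (hX : (∑ j : Fin p, cc j ^ p * G ^ (j : ℕ)) = RatFn.toFunctionField x₀ (u * ∏ i, s i ^ a i)) :
    ∃ (X : Scheme.{0}) (_ : IsIntegral X) (_ : IsLocallyNoetherian X) (σ : X ⟶ X₀) (_ : IsDominant σ) (C : Closeds X) (x : X) (n : ℕ),
      IsPointChainAlong σ C₀ C x n ∧ σ x = x₀ ∧ IsClosed ({x} : Set X) ∧
      CleanPermissibleAt p (RatFn.toFunctionField x) (RatFn.functionFieldMap σ G) (stalkIdeal (vanishingIdeal C) x) := by
  classical
  haveI : IsRegularLocalRing (X₀.presheaf.stalk x₀) := hX₀ x₀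
  haveI : CharP (X₀.presheaf.stalk x₀) p := (RatFn.toFunctionField x₀).charP (RatFn.toFunctionField_injective x₀) p
  obtain ⟨c2, hc2, hc2P⟩ := hC₀reg x₀ hx₀C
  -- `w ∈ 𝔪`, `w ∉ 𝓘`
  have hwm : w ∈ maximalIdeal (X₀.presheaf.stalk x₀) := hw.le (Ideal.mem_sup_right (Ideal.mem_span_singleton_self w))
  have hwP : w ∉ stalkIdeal (vanishingIdeal C₀) x₀ := by
    intro hwmem
    have hPeq : stalkIdeal (vanishingIdeal C₀) x₀ = maximalIdeal _ := by
      rw [← hw]; exact (sup_eq_left.mpr ((Ideal.span_singleton_le_iff_mem _).mpr hwmem)).symm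
    have h1 : ringKrullDim (X₀.presheaf.stalk x₀ ⧸ stalkIdeal (vanishingIdeal C₀) x₀) = 1 := by
      rw [← hc2P]; exact ringKrullDim_quotient_span_pair_eq_one hc2 hdim₀
    rw [hPeq] at h1
    have h0 : ringKrullDim (X₀.presheaf.stalk x₀ ⧸ maximalIdeal (X₀.presheaf.stalk x₀)) = 0 :=
      ringKrullDim_eq_zero_of_isField ((Ideal.Quotient.maximal_ideal_iff_isField_quotient _).mp inferInstance)
    rw [h0] at h1
    exact zero_ne_one h1
  rcases exists_pointChain_cleanPermissibleAt_or_uncharged_of_looseCleanForm hX₀ hC₀reg hx₀ hx₀C hdim₀ p G cc hcc w hw s hs a ha u hu hX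
    with hexit | ⟨-, γ, π, k, hγ, hπ, hsk, ⟨N', hN'⟩⟩
  · exact hexit
  by_cases hv : ∀ c : X₀.presheaf.stalk x₀, u * ∏ i, γ i ^ a i - c ^ p ∉ stalkIdeal (vanishingIdeal C₀) x₀
  · -- the unit part is not a `p`-th power modulo `𝓘`: restart exit (defectlessness from quasi-excellence)
    have hX' : (∑ j : Fin p, cc j ^ p * G ^ (j : ℕ)) = RatFn.toFunctionField x₀ (u * ∏ i, (γ i * w ^ k i + π i) ^ a i) := by
      rw [hX]; congr 1; exact congrArg (u * ·) (Finset.prod_congr rfl fun i _ => by rw [hsk i])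
    exact exists_pointChain_cleanPermissibleAt_of_isQuasiExcellent hX₀ hE p hC₀reg hx₀ hx₀C hdim₀ G cc hcc w u hw hu γ π hγ hπ k a
      (N' := N') (by rw [hN', mul_comm]) hX' hv
  · -- the unit part IS a `p`-th power modulo `𝓘`: then the representative is not a `p`-th power modulo `𝓘²` — first-order collapse
    push Not at hv
    obtain ⟨c₀, hc₀⟩ := hv
    have key : ∀ c : X₀.presheaf.stalk x₀, u * ∏ i, s i ^ a i - c ^ p ∉ stalkIdeal (vanishingIdeal C₀) x₀ ^ 2 :=
      transversal_rep_not_pow_mod_sq p hc2 hc2P w hwP hwm hm hs γ π hγ hπ k a hsk ha u hu (N' := N') (by rw [hN', mul_comm]) c₀ hc₀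
    exact exists_pointChain_cleanPermissibleAt_of_rep_not_pow_mod_sq hX₀ hE p hC₀reg hx₀ hx₀C hdim₀ w hw G cc hcc _ hX key

/-- **L7b (O8 of the X44c work plan), PROVED.**  On a regular integral quasi-excellent `X₀` with `char K(X₀) = p`, let `C₀` be a regular curve,
`x₀ ∈ C₀` a closed point with `dim 𝒪_{X₀,x₀} = 3` and `w` a transversal parameter (`𝓘_{C₀,x₀} + (w) = 𝔪_{x₀}`).  If the line of `G` is
clean-regular at `x₀` then a dominant chain of point blowing ups following `C₀` ends at a closed point `x` over `x₀` at which the line of `σ^♯ G` is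
CLEAN-PERMISSIBLE for the strict transform of `C₀`. [cite: CossartJannsenSaito2020, proof of Thm. 6.28, Step 5]
[cite: CossartPiltant2008, Prop. 4.4 (proof, p. 10)] [cite: Piltant2013, §2 Axiom 4] -/
theorem exists_pointChain_cleanPermissibleAt_of_cleanRegAt {X₀ : Scheme.{0}} [IsIntegral X₀] [IsLocallyNoetherian X₀]
    (hX₀ : Scheme.IsRegular X₀) (hE : Scheme.IsQuasiExcellent X₀) (p : ℕ) [hp : Fact p.Prime] [CharP X₀.functionField p] {C₀ : Closeds X₀}
    (hC₀reg : ∀ y ∈ (C₀ : Set X₀), ∃ c : Fin 2 → X₀.presheaf.stalk y,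
      IsRsopPart c ∧ Ideal.span (Set.range c) = stalkIdeal (vanishingIdeal C₀) y)
    {x₀ : X₀} (hx₀ : IsClosed ({x₀} : Set X₀)) (hx₀C : x₀ ∈ (C₀ : Set X₀)) (hdim₀ : ringKrullDim (X₀.presheaf.stalk x₀) = 3)
    [hP : (stalkIdeal (vanishingIdeal C₀) x₀).IsPrime]
    (w : X₀.presheaf.stalk x₀) (hw : stalkIdeal (vanishingIdeal C₀) x₀ ⊔ Ideal.span {w} = maximalIdeal _)
    (G : X₀.functionField) (hG : CleanRegAt p (RatFn.toFunctionField x₀) G) :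
    ∃ (X : Scheme.{0}) (_ : IsIntegral X) (_ : IsLocallyNoetherian X) (σ : X ⟶ X₀) (_ : IsDominant σ) (C : Closeds X) (x : X) (n : ℕ),
      IsPointChainAlong σ C₀ C x n ∧ σ x = x₀ ∧ IsClosed ({x} : Set X) ∧
      CleanPermissibleAt p (RatFn.toFunctionField x) (RatFn.functionFieldMap σ G) (stalkIdeal (vanishingIdeal C) x) := by
  classical
  haveI : IsRegularLocalRing (X₀.presheaf.stalk x₀) := hX₀ x₀
  obtain ⟨c2, hc2, hc2P⟩ := hC₀reg x₀ hx₀C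
  haveI : IsRegularLocalRing (X₀.presheaf.stalk x₀ ⧸ stalkIdeal (vanishingIdeal C₀) x₀) := by
    rw [← hc2P]; exact hc2.isRegularLocalRing_quotient
  obtain ⟨hregx, cc, hcc, hform⟩ := hG
  rcases hform with ⟨d, m, hmd, t, a, u, hu, hspan, hdim, hm, ha, hGX⟩ | ⟨u, hu, hGX, hup⟩ | ⟨s, c, hGX, hsc, hsc2⟩
  · -- form (1)
    have hd : (maximalIdeal (X₀.presheaf.stalk x₀)).spanFinrank = d := by
      have h := IsRegularLocalRing.spanFinrank_maximalIdeal (R := X₀.presheaf.stalk x₀)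
      rw [hdim] at h
      exact_mod_cast h
    have hs : IsRsopPart (t ∘ Fin.castLE hmd) := isRsopPart_comp_of_rsop hd t hspan (Fin.castLE hmd) (Fin.castLE_injective hmd)
    exact exists_pointChain_cleanPermissibleAt_of_monomialRep hX₀ hE p hC₀reg hx₀ hx₀C hdim₀ w hw G cc hcc hm (t ∘ Fin.castLE hmd) hs a ha
      u hu hGX
  · -- form (2): clean-permissible at `x₀` itself
    refine ⟨X₀, inferInstance, inferInstance, 𝟙 X₀, inferInstance, C₀, x₀, 0, IsPointChainAlong.nil C₀ x₀, rfl, hx₀, ?_⟩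
    rw [RatFn.functionFieldMap_id, RingHom.id_apply]
    exact cleanPermissibleAt_of_unit p _ G _ cc hcc u hu hGX hup
  · -- form (3): shift the representative; the new one is a regular parameter, i.e. form (1) with one factor
    obtain ⟨cc', hcc', hX'⟩ := rep_shift_sub_pow p (RatFn.toFunctionField x₀) G cc hcc s c hGX
    have hr : IsRsopPart ![s - c ^ p] := isRsopPart_singleton_of_not_mem_sq hsc hsc2
    have hX'' : (∑ j : Fin p, cc' j ^ p * G ^ (j : ℕ)) =
        RatFn.toFunctionField x₀ (1 * ∏ i : Fin 1, (![s - c ^ p] : Fin 1 → _) i ^ (![1] : Fin 1 → ℕ) i) := by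
      rw [hX']; simp
    exact exists_pointChain_cleanPermissibleAt_of_monomialRep hX₀ hE p hC₀reg hx₀ hx₀C hdim₀ w hw G cc' hcc' Nat.one_pos ![s - c ^ p] hr ![1]
      (fun i => by fin_cases i; simpa using hp.out.one_lt.ne') 1 isUnit_one hX''

end Summit.ResolutionOfSingularities.ResolutionOfSingularities.Theorems.RadicialJung.CleanModels

end
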